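import Literature.Computability.AlgebraicComplexity.MS2001ClassVarieties
import Literature.Computability.AlgebraicComplexity.MS2001StableObstructionMultiplicityComplex
import Literature.Computability.AlgebraicComplexity.ZariskiClosureBaseChange
import HarnessLib

/-!
# GCT I, Example 5.2.1: `Sym^{ad}(X)` is an obstruction for `(perm_d, det_d)` (Mulmuley–Sohoni 2001)

Cell `val-lit` (D-0074 GROUP L), row MS2001-A (GCT I §4–§7), typer `val-lit-t01`. THEOREMS ONLY
(no definition, no named fact; D-0026). K. D. Mulmuley, M. Sohoni, *Geometric complexity theory I:
an approach to the P vs. NP and related problems*, SIAM J. Comput. 31 (2001) 496–526, §5.2.1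
"Example 1" (authors' version = AV, 2001-04-23, pp. 21–22; text of record
`HOME/bip/texts/MS2001-authorversion/all.txt` L1491–1531), as printed:

> "Let `X` be the variable matrix of size `d`, `V = Sym^d(X)`, the space of forms in `X` of degree
> `d`, and `G = SL(X) = SL_{d²}(ℂ)`. Let `f = perm(X)` and `g = det(X)`, with stabilizers `H` and
> `Q` respectively. We want to show that `f` is not in the closure of the `G`-orbit of `g` in
> `P(V)`. […] we construct an obstruction for the pair `(f, g)` using Theorem 5.1, which is
> applicable since `f = perm(X)` is stable with respect to the action of `G = SL(X)` (Theorem 4.7).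
> Let `W = Sym^r(X)` be the `G`-module of homogeneous polynomials of degree `r` in the entries of
> `X` where `r` is a multiple `ad` of `d` for some integer `a > 1`. The multiplicity of the trivial
> `H`-representation in `W` exceeds one, because `perm(X)^a ∈ W` is fixed by `H`, and so too the
> permanent of the matrix obtained by replacing each entry of `X` by its `a`th power. As a
> `Q`-module [7] `W = Σ_λ S_λ ⊗ S̃_λ` […] When `r = ad`, `S_λ ⊗ S̃_λ` is trivial as a `Q`-module
> precisely when `λ` is rectangular with `d` rows and `a` columns. Hence the multiplicity of the
> trivial `Q`-module in `W` is precisely one–this trivial module is generated by `det^a(X)`. By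
> Theorem 5.1, any `Sym^r(X)`, `r = ad`, `a > 1`, is an obstruction for the pair `(f, g)`."
> (AV pp. 21–22, all.txt L1491–1517.)

In the tree's vocabulary (the binders of the typed fact `MS2001_thm_5_1`, `MS2001ClassVarieties.lean`):
`V = Sym^d`, `G = slSubgroup (Fin d × Fin d) ℂ` acting by linear substitution (`linSubstRep`),
`f = perPoly (Fin d) ℂ`, `g = detPoly (Fin d) ℂ`, and "multiplicity of the trivial `H`- (resp.
`Q`-) representation in `W = Sym^r`" = `dim W^H = finrank (fixedForms (slSubgroup _ ℂ) f r)` (resp.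
with `g`), `H = SL ∩ Stab f`, `Q = SL ∩ Stab g` (`fixedForms`, `CharacterizedByStabilizer.lean`).
This file PROVES the three printed claims:

* **(Q)** `fixedForms_slSubgroup_detPoly_mul_eq`: `W^Q = k · det^a` for `W = Sym^{da}` — "the
  multiplicity of the trivial `Q`-module in `W` is precisely one–this trivial module is generated
  by `det^a(X)`" — over EVERY infinite field `k` (print: `ℂ`, via the Cauchy formula [7]); hence
  `finrank_fixedForms_slSubgroup_detPoly_mul` (`= 1`). Our proof is elementary (slice-free and Schur-free):
  a form `p` fixed by the left multiplications `X ↦ AX`, `A ∈ SL_d(k)` (which lie in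
  `SL_{d²} ∩ Stab(det_d)`: substitution matrix `Aᵀ ⊗ 1`, `linSubst_kronecker_detPoly`), satisfies
  `p(M) = p(diag(1,…,1,det M)) = q(det M)` for every invertible `M = (M·D⁻¹)·D`, so
  `(p − q(det_d)) · det_d` vanishes on `k^{d×d}`, whence `p = q(det_d)` (`MvPolynomial.funext`, `k`
  infinite) and, comparing homogeneous components, `p = q_a · det_d^a`. (By-product, ours:
  `fixedForms_slSubgroup_detPoly_eq_bot_of_not_dvd` — no invariants in degrees not divisible by `d`,
  the `Sym^r` case of BLMW 2011 Prop. 5.2.1's "if `n` does not divide `|π|`, then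
  `(S_π(E ⊗ F))^{H₀} = 0`".)
* **(H)** `two_le_finrank_fixedForms_slSubgroup_perPoly_mul`: `2 ≤ dim W^H` for `d ≥ 3`, `a ≥ 2`,
  over `ℂ` — "`perm(X)^a ∈ W` is fixed by `H`, and so too the permanent of the matrix obtained by
  replacing each entry of `X` by its `a`th power" (`perPoly ^ a` and
  `bind₁ (fun p => X p ^ a) perPoly`; `pow_perPoly_mem_fixedForms`,
  `bind₁_pow_perPoly_mem_fixedForms`). That the second form is fixed by ALL of `H` uses the
  shape of the stabilizer of `perm_d`, `d ≥ 3` (monomial sandwiches `X ↦ D P_π X^{(T)} P_ρ L`,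
  `(∏ d)(∏ l) = 1`) — Marcus–May 1962, PROVED in the tree
  (`marcusMay1962_perPreserver_sandwich_holds`, `PerStabilizerMarcusMayProofs.lean`); the two forms
  are independent by evaluation at the identity and at the all-ones matrix
  (`linearIndependent_pow_perPoly_bind₁`).
* **(C)** `MS2001_example_5_2_1_obstruction` (`dim W^Q < dim W^H` for `W = Sym^{da}`, `d ≥ 3`,
  `a ≥ 2`: "any `Sym^r(X)`, `r = ad`, `a > 1`, is an obstruction for the pair `(f, g)`" — the
  hypothesis of Thm. 5.1 in its typed shape) and `MS2001_example_5_2_1`: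
  `perPoly (Fin d) ℂ ∉ orbitClosure (detPoly (Fin d) ℂ)` for `d ≥ 3` ("`f` is not in the closure of
  the `G`-orbit of `g` in `P(V)`", in the affine-cone rendering `Δ[g] = \overline{GL·g}` of the
  typed fact), by the tree's PROVED multiplicity form of Thm. 5.1 over `ℂ`
  (`MS2001_thm_5_1_complex`, `MS2001StableObstructionMultiplicityComplex.lean`, val-lit t02 g8)
  and Thm. 4.7 over `ℂ` (`MS2001_thm_4_7_complex`).
* **(C′)** `MS2001_example_5_2_1_charZero` (appended, val-lit t02 g9): the same conclusion
  `perPoly (Fin d) F ∉ orbitClosure (detPoly (Fin d) F)` over EVERY field `F` of characteristic `0`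
  (print: `ℂ`; Thm. 5.1's setting: algebraically closed of characteristic `0`), by base change from
  the `ℂ` theorem — `perm_d`, `det_d` are defined over `ℚ`, and orbit-closure membership descends
  along `ℚ ⊆ F` and ascends along `ℚ ⊆ ℂ` (`mem_orbitClosure_of_map_mem`,
  `map_mem_orbitClosure_map`, `ZariskiClosureBaseChange.lean`, val-lit x3 g5). A consequence of
  base change; no printed locator claimed.

Not restated: the example's first proof ("by just dimension considerations … the dimension of
`Q` exceeds that of `H`", AV p. 22 L1502–1505; no dimension theory of algebraic groups in the
tree) and the Cauchy decomposition `W = Σ_λ S_λ ⊗ S̃_λ` itself (only its consequence (Q) is proved,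
directly). The bound `d ≥ 3` is where Marcus–May applies (for `d = 2`, `perm₂` and `det₂` are
`GL₄`-equivalent and no obstruction exists); `a ≥ 2` is the printed `a > 1` (for `a = 1` the two
`H`-fixed forms coincide).

Honest framing: a 2001 worked example; `perm_d ∉ \overline{GL_{d²}·det_d}` (`m = n`) is classical
and is already a theorem of the tree on the Summit side by a different multiplicity obstruction
(`Summit.….NoValuativeFlip.not_hasBorderDetRepr_self`); what is vendored here is MS's
representation-theoretic witness `W = Sym^{ad}(X)` in the vocabulary of the typed Thm. 5.1.
VP ≠ VNP is NOT proved and nothing here bears on it.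

## References

* [MulmuleySohoniSIAM2001] K. D. Mulmuley, M. Sohoni, *Geometric complexity theory I*, SIAM J.
  Comput. 31 (2001) 496–526; AV §5.2.1 Example 1, pp. 21–22 (all.txt L1491–1531); Thm. 5.1 p. 20
  (L1365); Thm. 4.7 p. 15 (L952).
* [MarcusMay1962] M. Marcus, F. C. May, *The permanent function*, Canad. J. Math. 14 (1962)
  177–189, §2 Theorem (the stabilizer of `perm`); tree `marcusMay1962_perPreserver_sandwich_holds`.
* [BurgisserEtAl2011] P. Bürgisser, J. M. Landsberg, L. Manivel, J. Weyman, SIAM J. Comput. 40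
  (2011), §5.2 Prop. 5.2.1 (the `det` side in Schur-functor generality; cf. the tree's
  `BLMW2011_prop_5_2_1_invariants_holds`).

## Design

`namespace Literature.Computability.AlgebraicComplexity`; helpers in the sub-namespace
`MS2001Example521`. Part (Q) is stated over any infinite field `k` (any characteristic); parts (H),
(C) over `ℂ` (Marcus–May and Thm. 5.1 are vendored over `ℂ`). Degrees are written `d * a`.
Imports: `MS2001ClassVarieties` (typed row: `MS2001_thm_4_7_complex`, `slSubgroup`, `fixedForms`,
Marcus–May, `linSubst_kronecker_detPoly`) and `MS2001StableObstructionMultiplicityComplex`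
(`MS2001_thm_5_1_complex`); `ZariskiClosureBaseChange` (descent/ascent of orbit-closure membership,
for (C′)). Standard axioms only.
-/

noncomputable section

open MvPolynomial Matrix Finset

open scoped Kronecker

namespace Literature.Computability.AlgebraicComplexity

namespace MS2001Example521

/-! ## §0 Evaluation helpers -/

/-- Evaluating a linear substitution: `(M · f)(x) = f(Mᵀ x)` (the convention of `linSubst`,
`X i ↦ ∑ j, M j i • X j`; same computation as the private helpers of `PerStabilizerMarcusMay.lean` /
`CharacterizedByStabilizerSL.lean`, here over any commutative ring). [folklore] -/
private theorem eval_linSubst {σ R : Type*} [Fintype σ] [CommRing R] (M : Matrix σ σ R) (x : σ → R)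
    (f : MvPolynomial σ R) : eval x (linSubst σ R M f) = eval (Mᵀ *ᵥ x) f := by
  induction f using MvPolynomial.induction_on with
  | C a => rw [linSubst_C, eval_C, eval_C]
  | add p q hp hq => rw [map_add, map_add, map_add, hp, hq]
  | mul_X p i hp =>
    rw [map_mul, map_mul, map_mul, hp, linSubst_X, eval_X]
    congr 1
    simp [Matrix.mulVec, dotProduct, smul_eval]

/-- `aeval f p = eval f p` for the `R`-algebra `R` (Mathlib's `MvPolynomial.aeval_eq_eval`, applied).
[folklore] -/
private theorem aeval_apply_eq_eval {σ R : Type*} [CommSemiring R] (f : σ → R) (p : MvPolynomial σ R) :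
    aeval f p = eval f p := rfl

/-- The point of `k^{d×d}` underlying a matrix, and back: `of (fun i j => x (i, j))` at the point
`fun q => M q.1 q.2` is `M`. [folklore] -/
private theorem of_point {R : Type*} {d : ℕ} (M : Matrix (Fin d) (Fin d) R) :
    (Matrix.of fun i j : Fin d => (fun q : Fin d × Fin d => M q.1 q.2) (i, j)) = M :=
  Matrix.ext fun _ _ => rfl

/-- The substitution matrix `A ⊗ 1` acts on points as left multiplication by `Aᵀ`:
`mat((A ⊗ 1)ᵀ x) = Aᵀ · mat(x)`. [folklore] -/
private theorem of_kronecker_one_transpose_mulVec {R : Type*} [CommRing R] {d : ℕ}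
    (A : Matrix (Fin d) (Fin d) R) (x : Fin d × Fin d → R) :
    (Matrix.of fun i j : Fin d => ((A ⊗ₖ (1 : Matrix (Fin d) (Fin d) R))ᵀ *ᵥ x) (i, j)) =
      Aᵀ * Matrix.of fun i j : Fin d => x (i, j) := by
  ext i j
  simp only [Matrix.of_apply, Matrix.mulVec, dotProduct, Matrix.transpose_apply,
    Matrix.mul_apply]
  rw [Fintype.sum_prod_type]
  refine Finset.sum_congr rfl fun i' _ => ?_
  simp [Matrix.kroneckerMap_apply, Matrix.one_apply, mul_ite, ite_mul, Finset.sum_ite_eq']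

/-! ## §1 (Q) The `det` side: `W^{SL ∩ Stab(det_d)} = k · det_d^a` in degree `da`, `0` otherwise -/

section DetSide

variable {k : Type*} [Field k] {d : ℕ}

/-- `det (A ⊗ 1_d) = (det A)^d` on `Fin d × Fin d`. [folklore] -/
private theorem det_kronecker_one (A : Matrix (Fin d) (Fin d) k) :
    (A ⊗ₖ (1 : Matrix (Fin d) (Fin d) k)).det = A.det ^ d := by
  rw [Matrix.det_kronecker]
  simp

/-- **Left multiplications lie in `SL_{d²} ∩ Stab(det_d)` and fix every form of `W^Q`.** If `p` is
fixed by every determinant-one substitution fixing `det_d`, then `p(A M) = p(M)` for all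
`A ∈ SL_d(k)` and all `M` (substitution matrix `Aᵀ ⊗ 1`: determinant `(det A)^d = 1`,
`(Aᵀ ⊗ 1) · det_d = det(Aᵀ) det(1) det_d = det_d` by `linSubst_kronecker_detPoly`).
[cite: MulmuleySohoniSIAM2001, §5.2.1 Example 1 (AV p.22, all.txt L1509–1513: "the elements in `Q` of the form `(A, B)`, `A, B ∈ GL_d`, `det(AB⁻¹) = 1`")] -/
theorem eval_mul_eq_of_mem_fixedForms {p : MvPolynomial (Fin d × Fin d) k} {r : ℕ}
    (hp : p ∈ fixedForms (slSubgroup (Fin d × Fin d) k) (detPoly (Fin d) k) r)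
    (A : Matrix (Fin d) (Fin d) k) (hA : A.det = 1) (M : Matrix (Fin d) (Fin d) k) :
    eval (fun q : Fin d × Fin d => (A * M) q.1 q.2) p = eval (fun q : Fin d × Fin d => M q.1 q.2) p := by
  -- the substitution `γ = Aᵀ ⊗ 1 ∈ SL_{d²}`
  have hdet : (Aᵀ ⊗ₖ (1 : Matrix (Fin d) (Fin d) k)).det = 1 := by
    rw [det_kronecker_one, Matrix.det_transpose, hA, one_pow]
  let γ : GL (Fin d × Fin d) k :=
    Matrix.SpecialLinearGroup.toGL ⟨Aᵀ ⊗ₖ (1 : Matrix (Fin d) (Fin d) k), hdet⟩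
  have hγcoe : ((γ : GL (Fin d × Fin d) k) : Matrix (Fin d × Fin d) (Fin d × Fin d) k) =
      Aᵀ ⊗ₖ (1 : Matrix (Fin d) (Fin d) k) := rfl
  have hγsl : γ ∈ slSubgroup (Fin d × Fin d) k := ⟨_, rfl⟩
  have hγdet : linSubstRep (Fin d × Fin d) k γ (detPoly (Fin d) k) = detPoly (Fin d) k := by
    rw [linSubstRep_apply, hγcoe, Literature.NumberTheory.DiophantineGeometry.linSubst_kronecker_detPoly,
      Matrix.det_transpose, hA, Matrix.det_one, one_mul, one_smul]
  have hfix := (mem_fixedForms_iff.mp hp).2 γ hγsl hγdet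
  -- evaluate `γ · p = p` at the point of `M`
  have heval := congrArg (eval fun q : Fin d × Fin d => M q.1 q.2) hfix
  rw [linSubstRep_apply, hγcoe, eval_linSubst] at heval
  have hpt : (fun q : Fin d × Fin d => (A * M) q.1 q.2) =
      (Aᵀ ⊗ₖ (1 : Matrix (Fin d) (Fin d) k))ᵀ *ᵥ fun q : Fin d × Fin d => M q.1 q.2 := by
    funext q
    obtain ⟨i, j⟩ := q
    have h := congr_fun (congr_fun (of_kronecker_one_transpose_mulVec Aᵀ
      (fun q : Fin d × Fin d => M q.1 q.2)) i) j
    rw [Matrix.of_apply, Matrix.transpose_transpose, of_point] at h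
    exact h.symm
  exact (congrArg (fun v => eval v p) hpt).trans heval

/-- The determinant of `D(t) = diag(1, …, t, …, 1)` (`t` in position `i₀`) is `t`. [folklore] -/
private theorem det_diagonal_update (i₀ : Fin d) (t : k) :
    (Matrix.diagonal fun i : Fin d => if i = i₀ then t else 1).det = t := by
  rw [Matrix.det_diagonal, Finset.prod_ite_eq']
  simp

/-- `D(s) · D(t) = D(s t)`. [folklore] -/
private theorem diagonal_update_mul (i₀ : Fin d) (s t : k) :
    (Matrix.diagonal fun i : Fin d => if i = i₀ then s else 1) *
        (Matrix.diagonal fun i : Fin d => if i = i₀ then t else 1) =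
      Matrix.diagonal fun i : Fin d => if i = i₀ then s * t else 1 := by
  rw [Matrix.diagonal_mul_diagonal]
  congr 1
  funext i
  split_ifs <;> simp

/-- **Density step.** A polynomial function `P` on `k^{d×d}` with `P(A M) = P(M)` for all
`A ∈ SL_d(k)` satisfies `P(M) = P(D(det M))` for every invertible `M`, since
`M = (M · D(det M)⁻¹) · D(det M)` with `det (M · D(det M)⁻¹) = 1`. [folklore] -/
private theorem eval_eq_eval_diagonal_of_invariant (i₀ : Fin d) {p : MvPolynomial (Fin d × Fin d) k}
    (hinv : ∀ (A : Matrix (Fin d) (Fin d) k), A.det = 1 → ∀ M : Matrix (Fin d) (Fin d) k,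
      eval (fun q : Fin d × Fin d => (A * M) q.1 q.2) p = eval (fun q : Fin d × Fin d => M q.1 q.2) p)
    (M : Matrix (Fin d) (Fin d) k) (hM : M.det ≠ 0) :
    eval (fun q : Fin d × Fin d => M q.1 q.2) p =
      eval (fun q : Fin d × Fin d =>
        (Matrix.diagonal fun i : Fin d => if i = i₀ then M.det else 1) q.1 q.2) p := by
  have hDD : (Matrix.diagonal fun i : Fin d => if i = i₀ then (M.det)⁻¹ else 1) *
      (Matrix.diagonal fun i : Fin d => if i = i₀ then M.det else 1) = 1 := by
    rw [diagonal_update_mul, inv_mul_cancel₀ hM, ← Matrix.diagonal_one]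
    congr 1
    funext i
    split_ifs <;> rfl
  have hA : (M * Matrix.diagonal fun i : Fin d => if i = i₀ then (M.det)⁻¹ else 1).det = 1 := by
    rw [Matrix.det_mul, det_diagonal_update, mul_inv_cancel₀ hM]
  have h := hinv _ hA (Matrix.diagonal fun i : Fin d => if i = i₀ then M.det else 1)
  rw [Matrix.mul_assoc, hDD, Matrix.mul_one] at h
  exact h

/-- The one-variable restriction `q(T) = p(D(T))` of `p` to the curve `T ↦ diag(1,…,T,…,1)`
(inline: `aeval (fun ij => D(T)_{ij}) p`); its value at `t` is `p(D(t))`. [folklore] -/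
private theorem eval_restrict_diagonal (i₀ : Fin d) (p : MvPolynomial (Fin d × Fin d) k) (t : k) :
    Polynomial.eval t (aeval (fun ij : Fin d × Fin d =>
        (Matrix.diagonal fun i : Fin d => if i = i₀ then (Polynomial.X : Polynomial k) else 1)
          ij.1 ij.2) p) =
      eval (fun q : Fin d × Fin d =>
        (Matrix.diagonal fun i : Fin d => if i = i₀ then t else 1) q.1 q.2) p := by
  have hFG : (fun ij : Fin d × Fin d => (Polynomial.aeval t)
      ((Matrix.diagonal fun i : Fin d => if i = i₀ then (Polynomial.X : Polynomial k) else 1)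
        ij.1 ij.2)) =
      fun q : Fin d × Fin d => (Matrix.diagonal fun i : Fin d => if i = i₀ then t else 1) q.1 q.2 := by
    funext ij
    simp only [Matrix.diagonal_apply]
    split_ifs <;> simp
  rw [← Polynomial.coe_aeval_eq_eval, ← AlgHom.comp_apply, MvPolynomial.comp_aeval, hFG,
    aeval_apply_eq_eval]

/-- **`W^Q ⊆ k[det_d]`:** a polynomial `p` with `p(AM) = p(M)` for all `A ∈ SL_d(k)`, `k` an
infinite field, is a polynomial in `det_d`: `p = q(det_d)` with `q(T) = p(D(T))` — because
`(p − q(det_d)) · det_d` vanishes identically on `k^{d×d}` (MS: the trivial `Q`-modules in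
`⊕_r Sym^r(X)` are generated by the powers of `det(X)`). Our elementary proof.
[cite: MulmuleySohoniSIAM2001, §5.2.1 Example 1 (AV p.22, all.txt L1513–1516)] -/
theorem eq_aeval_detPoly_of_invariant [Infinite k] (i₀ : Fin d) {p : MvPolynomial (Fin d × Fin d) k}
    (hinv : ∀ (A : Matrix (Fin d) (Fin d) k), A.det = 1 → ∀ M : Matrix (Fin d) (Fin d) k,
      eval (fun q : Fin d × Fin d => (A * M) q.1 q.2) p = eval (fun q : Fin d × Fin d => M q.1 q.2) p) :
    p = Polynomial.aeval (detPoly (Fin d) k) (aeval (fun ij : Fin d × Fin d =>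
        (Matrix.diagonal fun i : Fin d => if i = i₀ then (Polynomial.X : Polynomial k) else 1)
          ij.1 ij.2) p) := by
  set q : Polynomial k := aeval (fun ij : Fin d × Fin d =>
    (Matrix.diagonal fun i : Fin d => if i = i₀ then (Polynomial.X : Polynomial k) else 1)
      ij.1 ij.2) p with hq
  -- `(p - q(det)) * det` vanishes everywhere
  have hzero : (p - Polynomial.aeval (detPoly (Fin d) k) q) * detPoly (Fin d) k = 0 := by
    apply MvPolynomial.funext
    intro x
    rw [map_zero, map_mul, eval_detPoly]
    set M : Matrix (Fin d) (Fin d) k := Matrix.of fun i j => x (i, j) with hMdef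
    have hx : x = fun q : Fin d × Fin d => M q.1 q.2 := by
      funext q; simp [hMdef]
    by_cases hM : M.det = 0
    · rw [hM, mul_zero]
    · rw [map_sub, hx]
      have h1 := eval_eq_eval_diagonal_of_invariant i₀ hinv M hM
      have h2 : eval (fun q : Fin d × Fin d => M q.1 q.2)
          (Polynomial.aeval (detPoly (Fin d) k) q) = Polynomial.eval M.det q := by
        have h := (Polynomial.aeval_algHom_apply
          (MvPolynomial.aeval fun q : Fin d × Fin d => M q.1 q.2) (detPoly (Fin d) k) q).symm
        rw [aeval_apply_eq_eval, aeval_apply_eq_eval, eval_detPoly, of_point,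
          Polynomial.coe_aeval_eq_eval] at h
        exact h
      rw [h2, hq, eval_restrict_diagonal, h1, sub_self, zero_mul]
  have hdet : detPoly (Fin d) k ≠ 0 := by
    simpa [detPoly] using Matrix.det_mvPolynomialX_ne_zero (Fin d) k
  exact sub_eq_zero.mp ((mul_eq_zero.mp hzero).resolve_right hdet)

/-- `det_d^i` is a form of degree `d i`. [folklore] -/
private theorem detPoly_pow_isHomogeneous (i : ℕ) :
    ((detPoly (Fin d) k) ^ i).IsHomogeneous (d * i) := by
  have h : (detPoly (Fin d) k).IsHomogeneous d := by
    simpa using detPoly_isHomogeneous (n := Fin d) (k := k)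
  exact h.pow i

/-- **Homogeneous components of a polynomial in `det_d`:** the degree-`r` component of
`q(det_d) = ∑ᵢ qᵢ det_d^i` (`d ≥ 1`) is `q_{r/d} det_d^{r/d}` if `d ∣ r` and `0` otherwise.
[folklore] -/
private theorem homogeneousComponent_aeval_detPoly (hd : 0 < d) (q : Polynomial k) (r : ℕ) :
    homogeneousComponent r (Polynomial.aeval (detPoly (Fin d) k) q) =
      if d ∣ r then q.coeff (r / d) • (detPoly (Fin d) k) ^ (r / d) else 0 := by
  have hc : ∀ i : ℕ, homogeneousComponent r ((detPoly (Fin d) k) ^ i) =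
      if r = d * i then (detPoly (Fin d) k) ^ i else 0 := fun i =>
    homogeneousComponent_of_mem ((mem_homogeneousSubmodule _ _).mpr (detPoly_pow_isHomogeneous i))
  rw [Polynomial.aeval_eq_sum_range, map_sum]
  simp_rw [map_smul, hc]
  split_ifs with hdr
  · obtain ⟨c, rfl⟩ := hdr
    rw [Nat.mul_div_cancel_left c hd]
    have : ∀ i : ℕ, (q.coeff i • (if d * c = d * i then detPoly (Fin d) k ^ i else 0)) =
        if c = i then q.coeff c • detPoly (Fin d) k ^ c else 0 := by
      intro i
      by_cases hci : c = i
      · subst hci; simp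
      · have : d * c ≠ d * i := fun h => hci (Nat.eq_of_mul_eq_mul_left hd h)
        simp [hci, this]
    simp_rw [this]
    rw [Finset.sum_ite_eq]
    split_ifs with hc'
    · rfl
    · -- `c` beyond the degree of `q`: the coefficient vanishes
      rw [Finset.mem_range, not_lt] at hc'
      rw [Polynomial.coeff_eq_zero_of_natDegree_lt (by omega), zero_smul]
  · refine Finset.sum_eq_zero fun i _ => ?_
    have : r ≠ d * i := fun h => hdr ⟨i, h⟩
    simp [this]

/-- **(Q), as printed: "the multiplicity of the trivial `Q`-module in `W` is precisely one–this
trivial module is generated by `det^a(X)`"** (MS 2001, §5.2.1, AV p.22, all.txt L1513–1516), for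
`W = Sym^{da}(X)`, `Q = SL_{d²} ∩ Stab(det_d)`, in the tree's rendering
`fixedForms (slSubgroup _ k) det_d (d a) = k ∙ det_d^a` — PROVED over every infinite field `k`
(print: `k = ℂ`, by the Cauchy formula; here by left-`SL_d` density and homogeneity).
[cite: MulmuleySohoniSIAM2001, §5.2.1 Example 1 (AV p.22, all.txt L1509–1516)] -/
theorem fixedForms_slSubgroup_detPoly_mul_eq (k : Type*) [Field k] [Infinite k] (d a : ℕ) :
    fixedForms (slSubgroup (Fin d × Fin d) k) (detPoly (Fin d) k) (d * a) =
      k ∙ (detPoly (Fin d) k) ^ a := by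
  refine le_antisymm ?_ ?_
  · intro p hp
    rcases Nat.eq_zero_or_pos d with rfl | hd
    · -- no variables: `p` is a constant, `det_0 = 1`
      have hp0 : p.IsHomogeneous 0 := by simpa using (mem_fixedForms_iff.mp hp).1
      have hdet1 : detPoly (Fin 0) k = 1 := by
        simp [detPoly, Matrix.det_isEmpty]
      rw [hdet1, one_pow]
      have hpC : p = C (coeff 0 p) := by
        rw [← totalDegree_eq_zero_iff_eq_C]
        exact Nat.le_zero.mp hp0.totalDegree_le
      rw [hpC, ← mul_one (C (coeff 0 p)), ← smul_eq_C_mul]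
      exact Submodule.smul_mem _ _ (Submodule.mem_span_singleton_self _)
    · have hinv : ∀ (A : Matrix (Fin d) (Fin d) k), A.det = 1 → ∀ M : Matrix (Fin d) (Fin d) k,
          eval (fun q : Fin d × Fin d => (A * M) q.1 q.2) p =
            eval (fun q : Fin d × Fin d => M q.1 q.2) p :=
        fun A hA M => eval_mul_eq_of_mem_fixedForms hp A hA M
      have hpq := eq_aeval_detPoly_of_invariant ⟨0, hd⟩ hinv
      have hcomp : homogeneousComponent (d * a) p = p := by
        rw [homogeneousComponent_of_mem
          ((mem_homogeneousSubmodule _ _).mpr (mem_fixedForms_iff.mp hp).1), if_pos rfl]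
      rw [← hcomp, hpq, homogeneousComponent_aeval_detPoly hd, if_pos (dvd_mul_right d a),
        Nat.mul_div_cancel_left a hd]
      exact Submodule.smul_mem _ _ (Submodule.mem_span_singleton_self _)
  · rw [Submodule.span_le, Set.singleton_subset_iff]
    refine mem_fixedForms_iff.mpr ⟨detPoly_pow_isHomogeneous a, fun γ _ hγ => ?_⟩
    rw [linSubstRep_apply] at hγ ⊢
    rw [map_pow, hγ]

/-- **`dim W^Q = 1`** for `W = Sym^{da}(X)`, `Q = SL_{d²} ∩ Stab(det_d)` ("precisely one"), every
infinite field. [cite: MulmuleySohoniSIAM2001, §5.2.1 Example 1 (AV p.22, all.txt L1513–1516)] -/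
theorem finrank_fixedForms_slSubgroup_detPoly_mul (k : Type*) [Field k] [Infinite k] (d a : ℕ) :
    Module.finrank k (fixedForms (slSubgroup (Fin d × Fin d) k) (detPoly (Fin d) k) (d * a)) = 1 := by
  rw [fixedForms_slSubgroup_detPoly_mul_eq]
  refine finrank_span_singleton (pow_ne_zero _ ?_)
  simpa [detPoly] using Matrix.det_mvPolynomialX_ne_zero (Fin d) k

/-- **No `Q`-invariants in degrees not divisible by `d`** (ours; the `Sym^r` case of BLMW 2011,
Prop. 5.2.1: "if `n` does not divide `|π|`, then `(S_π(E ⊗ F))^{H₀} = 0`"): for `d ∤ r`,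
`fixedForms (slSubgroup _ k) det_d r = ⊥`, every infinite field. Our elementary proof.
[cite: BurgisserEtAl2011, Prop. 5.2.1 (divisibility clause)] -/
theorem fixedForms_slSubgroup_detPoly_eq_bot_of_not_dvd (k : Type*) [Field k] [Infinite k] {d r : ℕ}
    (hdr : ¬ d ∣ r) :
    fixedForms (slSubgroup (Fin d × Fin d) k) (detPoly (Fin d) k) r = ⊥ := by
  rw [Submodule.eq_bot_iff]
  intro p hp
  have hpr : p.IsHomogeneous r := (mem_fixedForms_iff.mp hp).1
  rcases Nat.eq_zero_or_pos d with rfl | hd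
  · -- no variables: a form of positive degree vanishes
    have hr : r ≠ 0 := by
      rintro rfl
      exact hdr (dvd_refl 0)
    by_contra hp0
    exact hr ((isHomogeneous_of_isEmpty (f := p)).inj_right hpr hp0).symm
  · have hinv : ∀ (A : Matrix (Fin d) (Fin d) k), A.det = 1 → ∀ M : Matrix (Fin d) (Fin d) k,
        eval (fun q : Fin d × Fin d => (A * M) q.1 q.2) p =
          eval (fun q : Fin d × Fin d => M q.1 q.2) p :=
      fun A hA M => eval_mul_eq_of_mem_fixedForms hp A hA M
    have hpq := eq_aeval_detPoly_of_invariant ⟨0, hd⟩ hinv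
    have hcomp : homogeneousComponent r p = p := by
      rw [homogeneousComponent_of_mem ((mem_homogeneousSubmodule _ _).mpr hpr), if_pos rfl]
    rw [← hcomp, hpq, homogeneousComponent_aeval_detPoly hd, if_neg hdr]

end DetSide

/-! ## §2 (H) The `perm` side: `perm_d^a` and `perm(X^{∘a})` lie in `W^{SL ∩ Stab(perm_d)}` -/

section PerSide

variable {k : Type*} [Field k] {d : ℕ}

/-- Entries of a monomial sandwich: `(D P_π X P_ρ L)_{ij} = d_i · X_{π i, ρ⁻¹ j} · l_j`
(as the private `sandwich_apply` of `CharacterizedByStabilizerSL.lean`). [folklore] -/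
private theorem sandwich_apply {ι R : Type*} [Fintype ι] [DecidableEq ι] [CommRing R]
    (dd l : ι → R) (π ρ : Equiv.Perm ι) (X : Matrix ι ι R) (i j : ι) :
    (diagonal dd * π.permMatrix R * X * ρ.permMatrix R * diagonal l) i j =
      dd i * X (π i) (ρ.symm j) * l j := by
  rw [Matrix.mul_diagonal, PEquiv.mul_toMatrix_toPEquiv, Matrix.submatrix_apply, id,
    Matrix.mul_assoc, Matrix.diagonal_mul, PEquiv.toMatrix_toPEquiv_mul, Matrix.submatrix_apply, id]

/-- **Entrywise powers commute with monomial sandwiches:**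
`(D P_π X P_ρ L)^{∘a} = D^a P_π X^{∘a} P_ρ L^a`. [folklore] -/
private theorem hadamardPow_sandwich {ι R : Type*} [Fintype ι] [DecidableEq ι] [CommRing R]
    (dd l : ι → R) (π ρ : Equiv.Perm ι) (X : Matrix ι ι R) (a : ℕ) :
    (Matrix.of fun i j => (diagonal dd * π.permMatrix R * X * ρ.permMatrix R * diagonal l) i j ^ a) =
      diagonal (fun i => dd i ^ a) * π.permMatrix R * (Matrix.of fun i j => X i j ^ a) *
        ρ.permMatrix R * diagonal (fun j => l j ^ a) := by
  ext i j
  rw [Matrix.of_apply, sandwich_apply, sandwich_apply, Matrix.of_apply, mul_pow, mul_pow]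

/-- Evaluating "the permanent of the matrix obtained by replacing each entry of `X` by its `a`th
power" (`bind₁ (fun p => X p ^ a) perPoly`) at a point: `per (x_{ij}^a)`.
[cite: MulmuleySohoniSIAM2001, §5.2.1 Example 1 (AV p.22, all.txt L1507–1509)] -/
theorem eval_bind₁_pow_perPoly {R : Type*} [CommRing R] (a : ℕ) (x : Fin d × Fin d → R) :
    eval x (bind₁ (fun p : Fin d × Fin d => (X p : MvPolynomial (Fin d × Fin d) R) ^ a)
        (perPoly (Fin d) R)) =
      (Matrix.of fun i j : Fin d => x (i, j) ^ a).permanent := by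
  rw [← aeval_apply_eq_eval, aeval_bind₁, aeval_apply_eq_eval]
  simp only [map_pow, aeval_X]
  exact eval_perPoly (n := Fin d) (k := R) fun p => x p ^ a

/-- `perm(X^{∘a})` ("the permanent of the matrix obtained by replacing each entry of `X` by its `a`th
power") is a form of degree `d a`, i.e. lies in `W = Sym^{ad}(X)`.
[cite: MulmuleySohoniSIAM2001, §5.2.1 Example 1 (AV p.22, all.txt L1506–1509)] -/
theorem bind₁_pow_perPoly_isHomogeneous {R : Type*} [CommRing R] (a : ℕ) :
    (bind₁ (fun p : Fin d × Fin d => (X p : MvPolynomial (Fin d × Fin d) R) ^ a)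
        (perPoly (Fin d) R)).IsHomogeneous (d * a) := by
  have hper : (perPoly (Fin d) R).IsHomogeneous d := by
    simpa using perPoly_isHomogeneous (n := Fin d) (k := R)
  have := hper.aeval (fun p : Fin d × Fin d => (X p : MvPolynomial (Fin d × Fin d) R) ^ a)
    (fun p => by simpa using (isHomogeneous_X R p).pow a)
  rw [aeval_eq_bind₁] at this
  simpa [mul_comm] using this

/-- **"`perm(X)^a ∈ W` is fixed by `H`"** (MS 2001, §5.2.1; `H = SL_{d²} ∩ Stab(perm_d)`): `perm_d^a`
lies in `fixedForms (slSubgroup _ k) perm_d (d a)`, any field, any `d`.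
[cite: MulmuleySohoniSIAM2001, §5.2.1 Example 1 (AV p.22, all.txt L1507–1508)] -/
theorem pow_perPoly_mem_fixedForms (a : ℕ) :
    (perPoly (Fin d) k) ^ a ∈ fixedForms (slSubgroup (Fin d × Fin d) k) (perPoly (Fin d) k) (d * a) := by
  refine mem_fixedForms_iff.mpr ⟨?_, fun γ _ hγ => ?_⟩
  · have hper : (perPoly (Fin d) k).IsHomogeneous d := by
      simpa using perPoly_isHomogeneous (n := Fin d) (k := k)
    exact hper.pow a
  · rw [linSubstRep_apply] at hγ ⊢
    rw [map_pow, hγ]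

/-- `∏ᵢ dᵢ^a · ∏ⱼ lⱼ^a = ((∏ d)(∏ l))^a`; `= 1` under the Marcus–May normalisation. [folklore] -/
private theorem prod_pow_mul_prod_pow_eq_one {R : Type*} [CommRing R] {dd l : Fin d → R}
    (hdl : (∏ i, dd i) * (∏ i, l i) = 1) (a : ℕ) :
    (∏ i, dd i ^ a) * (∏ i, l i ^ a) = 1 := by
  rw [Finset.prod_pow, Finset.prod_pow, ← mul_pow, hdl, one_pow]

/-- **"and so too the permanent of the matrix obtained by replacing each entry of `X` by its `a`th
power"** (MS 2001, §5.2.1, AV p.22, all.txt L1508–1509): for `d ≥ 3`, over `ℂ`,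
`perm(X^{∘a}) ∈ fixedForms (slSubgroup _ ℂ) perm_d (d a)`. Every `γ ∈ SL_{d²}` fixing `perm_d` acts
on matrices as a monomial sandwich `X ↦ D P_π X^{(T)} P_ρ L`, `(∏ d)(∏ l) = 1` (Marcus–May 1962,
tree `marcusMay1962_perPreserver_sandwich_holds`), and
`perm((D P_π X P_ρ L)^{∘a}) = ((∏ d)(∏ l))^a perm(X^{∘a}) = perm(X^{∘a})`.
[cite: MulmuleySohoniSIAM2001, §5.2.1 Example 1 (AV p.22, all.txt L1507–1509)]
[cite: MarcusMay1962, §2 Theorem, p. 179] -/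
theorem bind₁_pow_perPoly_mem_fixedForms (hd : 3 ≤ d) (a : ℕ) :
    bind₁ (fun p : Fin d × Fin d => (X p : MvPolynomial (Fin d × Fin d) ℂ) ^ a) (perPoly (Fin d) ℂ) ∈
      fixedForms (slSubgroup (Fin d × Fin d) ℂ) (perPoly (Fin d) ℂ) (d * a) := by
  refine mem_fixedForms_iff.mpr ⟨bind₁_pow_perPoly_isHomogeneous a, fun γ _ hγ => ?_⟩
  obtain ⟨π, ρ, dd, l, hdl, hcase⟩ :=
    marcusMay1962_perPreserver_sandwich_holds.of_mem_linStabilizer hd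
      ((mem_linStabilizer (f := perPoly (Fin d) ℂ)).mpr hγ)
  apply MvPolynomial.funext
  intro x
  rw [linSubstRep_apply, eval_linSubst, eval_bind₁_pow_perPoly, eval_bind₁_pow_perPoly]
  rcases hcase with hM | hM
  · have hmat : (Matrix.of fun i j : Fin d =>
        ((γ : Matrix (Fin d × Fin d) (Fin d × Fin d) ℂ)ᵀ *ᵥ x) (i, j) ^ a) =
        Matrix.of fun i j : Fin d => (diagonal dd * π.permMatrix ℂ *
          (Matrix.of fun i j : Fin d => x (i, j)) * ρ.permMatrix ℂ * diagonal l) i j ^ a := by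
      ext i j
      have h := congr_fun (congr_fun (hM x) i) j
      rw [Matrix.of_apply] at h
      rw [Matrix.of_apply, Matrix.of_apply, h]
    have hX : (Matrix.of fun i j : Fin d => (Matrix.of fun i j : Fin d => x (i, j)) i j ^ a) =
        Matrix.of fun i j : Fin d => x (i, j) ^ a := by
      ext i j; rfl
    rw [hmat, hadamardPow_sandwich, hX, MarcusMay.permanent_sandwich,
      prod_pow_mul_prod_pow_eq_one hdl, one_mul]
  · have hmat : (Matrix.of fun i j : Fin d =>
        ((γ : Matrix (Fin d × Fin d) (Fin d × Fin d) ℂ)ᵀ *ᵥ x) (i, j) ^ a) =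
        Matrix.of fun i j : Fin d => (diagonal dd * π.permMatrix ℂ *
          (Matrix.of fun i j : Fin d => x (i, j))ᵀ * ρ.permMatrix ℂ * diagonal l) i j ^ a := by
      ext i j
      have h := congr_fun (congr_fun (hM x) i) j
      rw [Matrix.of_apply] at h
      rw [Matrix.of_apply, Matrix.of_apply, h]
    have hT : (Matrix.of fun i j : Fin d => (Matrix.of fun i j : Fin d => x (i, j))ᵀ i j ^ a) =
        (Matrix.of fun i j : Fin d => x (i, j) ^ a)ᵀ := by
      ext i j; rfl
    rw [hmat, hadamardPow_sandwich, hT, MarcusMay.permanent_sandwich_transpose,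
      prod_pow_mul_prod_pow_eq_one hdl, one_mul]

/-- The permanent of the all-ones `d × d` matrix is `d!`. [folklore] -/
private theorem permanent_of_one {R : Type*} [CommRing R] :
    (Matrix.of fun _ _ : Fin d => (1 : R)).permanent = (d.factorial : R) := by
  simp [Matrix.permanent, Finset.card_univ, Fintype.card_perm]

/-- **The two `H`-fixed forms are linearly independent** (`d ≥ 2`, `a ≥ 2`, characteristic `0`):
evaluate `s · perm_d^a + t · perm(X^{∘a}) = 0` at the identity (`s + t = 0`) and at the all-ones
matrix (`s (d!)^a + t d! = 0`); `(d!)^a ≠ d!`. (MS: "the multiplicity of the trivial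
`H`-representation in `W` exceeds one".) [cite: MulmuleySohoniSIAM2001, §5.2.1 Example 1 (AV p.22, all.txt L1506–1509)] -/
theorem linearIndependent_pow_perPoly_bind₁ [CharZero k] (hd : 2 ≤ d) {a : ℕ} (ha : 2 ≤ a) :
    LinearIndependent k ![(perPoly (Fin d) k) ^ a,
      bind₁ (fun p : Fin d × Fin d => (X p : MvPolynomial (Fin d × Fin d) k) ^ a) (perPoly (Fin d) k)] := by
  rw [LinearIndependent.pair_iff]
  intro s t hst
  have ha0 : a ≠ 0 := by omega
  -- evaluation at the identity matrix
  have h1 := congrArg (eval fun q : Fin d × Fin d => (1 : Matrix (Fin d) (Fin d) k) q.1 q.2) hst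
  rw [map_add, smul_eval, smul_eval, map_pow, eval_perPoly, of_point, eval_bind₁_pow_perPoly,
    map_zero, Matrix.permanent_one, one_pow, mul_one] at h1
  have hI : (Matrix.of fun i j : Fin d =>
      (fun q : Fin d × Fin d => (1 : Matrix (Fin d) (Fin d) k) q.1 q.2) (i, j) ^ a) = 1 := by
    ext i j
    by_cases hij : i = j
    · subst hij; simp
    · simp [Matrix.one_apply, hij, ha0]
  rw [hI, Matrix.permanent_one, mul_one] at h1
  -- evaluation at the all-ones matrix
  have h2 := congrArg (eval fun _ : Fin d × Fin d => (1 : k)) hst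
  rw [map_add, smul_eval, smul_eval, map_pow, eval_perPoly, eval_bind₁_pow_perPoly, map_zero] at h2
  simp only [one_pow] at h2
  rw [permanent_of_one] at h2
  -- `s + t = 0`, `s (d!)^a + t d! = 0`, `(d!)^a ≠ d!`
  have ht : t = -s := by linear_combination h1
  rw [ht] at h2
  have hne : ((d.factorial : k)) ^ a - (d.factorial : k) ≠ 0 := by
    rw [sub_ne_zero, ← Nat.cast_pow, Ne, Nat.cast_inj]
    have h2le : 2 ≤ d.factorial := by
      calc 2 = Nat.factorial 2 := rfl
        _ ≤ d.factorial := Nat.factorial_le hd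
    intro h
    have : d.factorial ^ 2 ≤ d.factorial ^ a := Nat.pow_le_pow_right (by omega) ha
    nlinarith
  have hs : s = 0 := by
    have : s * (((d.factorial : k)) ^ a - (d.factorial : k)) = 0 := by linear_combination h2
    exact (mul_eq_zero.mp this).resolve_right hne
  exact ⟨hs, by rw [ht, hs, neg_zero]⟩

/-- **(H), as printed: "The multiplicity of the trivial `H`-representation in `W` exceeds one"**
(MS 2001, §5.2.1, AV p.22, all.txt L1506–1509), `W = Sym^{da}(X)`, `H = SL_{d²} ∩ Stab(perm_d)`,
`d ≥ 3`, `a ≥ 2` (print: `a > 1`), over `ℂ`: `2 ≤ finrank (fixedForms (slSubgroup _ ℂ) perm_d (d a))`.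
[cite: MulmuleySohoniSIAM2001, §5.2.1 Example 1 (AV p.22, all.txt L1506–1509)]
[cite: MarcusMay1962, §2 Theorem, p. 179] -/
theorem two_le_finrank_fixedForms_slSubgroup_perPoly_mul (hd : 3 ≤ d) {a : ℕ} (ha : 2 ≤ a) :
    2 ≤ Module.finrank ℂ (fixedForms (slSubgroup (Fin d × Fin d) ℂ) (perPoly (Fin d) ℂ) (d * a)) := by
  have hli := linearIndependent_pow_perPoly_bind₁ (k := ℂ) (d := d) (by omega) ha
  have hle : Submodule.span ℂ (Set.range ![(perPoly (Fin d) ℂ) ^ a,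
      bind₁ (fun p : Fin d × Fin d => (X p : MvPolynomial (Fin d × Fin d) ℂ) ^ a) (perPoly (Fin d) ℂ)]) ≤
      fixedForms (slSubgroup (Fin d × Fin d) ℂ) (perPoly (Fin d) ℂ) (d * a) := by
    rw [Submodule.span_le]
    rintro _ ⟨i, rfl⟩
    fin_cases i
    · simpa using pow_perPoly_mem_fixedForms (k := ℂ) (d := d) a
    · simpa using bind₁_pow_perPoly_mem_fixedForms hd a
  haveI : Module.Finite ℂ ↥(homogeneousSubmodule (Fin d × Fin d) ℂ (d * a)) :=
    finite_homogeneousSubmodule _ ℂ _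
  haveI : Module.Finite ℂ ↥(fixedForms (slSubgroup (Fin d × Fin d) ℂ) (perPoly (Fin d) ℂ) (d * a)) :=
    Submodule.finiteDimensional_of_le (fun p hp => hp.1)
  calc 2 = Module.finrank ℂ (Submodule.span ℂ (Set.range ![(perPoly (Fin d) ℂ) ^ a,
      bind₁ (fun p : Fin d × Fin d => (X p : MvPolynomial (Fin d × Fin d) ℂ) ^ a)
        (perPoly (Fin d) ℂ)])) := by rw [finrank_span_eq_card hli]; simp
    _ ≤ _ := Submodule.finrank_mono hle

end PerSide

end MS2001Example521

open MS2001Example521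

/-! ## §3 (C) The obstruction and the conclusion -/

/-- **GCT I, Example 5.2.1 — "any `Sym^r(X)`, `r = ad`, `a > 1`, is an obstruction for the pair
`(f, g)`"** (`f = perm_d`, `g = det_d`, `G = SL_{d²}(ℂ)`; MS 2001, AV p.22, all.txt L1516–1517), in
the typed hypothesis shape of Thm. 5.1 (`MS2001_thm_5_1`): for `d ≥ 3`, `a ≥ 2`,
`dim (Sym^{da})^{SL ∩ Stab(det_d)} = 1 < 2 ≤ dim (Sym^{da})^{SL ∩ Stab(perm_d)}`. PROVED (parts (Q) and
(H) of this file). [cite: MulmuleySohoniSIAM2001, §5.2.1 Example 1 (AV pp.21–22, all.txt L1491–1517)] -/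
theorem MS2001_example_5_2_1_obstruction {d : ℕ} (hd : 3 ≤ d) {a : ℕ} (ha : 2 ≤ a) :
    Module.finrank ℂ (fixedForms (slSubgroup (Fin d × Fin d) ℂ) (detPoly (Fin d) ℂ) (d * a)) <
      Module.finrank ℂ (fixedForms (slSubgroup (Fin d × Fin d) ℂ) (perPoly (Fin d) ℂ) (d * a)) := by
  rw [finrank_fixedForms_slSubgroup_detPoly_mul]
  exact lt_of_lt_of_le one_lt_two (two_le_finrank_fixedForms_slSubgroup_perPoly_mul hd ha)

/-- **GCT I (Mulmuley–Sohoni 2001), §5.2.1 Example 1 — PROVED over `ℂ`:** "Let `X` be the variable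
matrix of size `d`, `V = Sym^d(X)` […] `G = SL(X) = SL_{d²}(ℂ)`. Let `f = perm(X)` and `g = det(X)`
[…] `f` is not in the closure of the `G`-orbit of `g` in `P(V)`" (AV pp. 21–22, all.txt
L1491–1501), for `d ≥ 3`, in the affine-cone rendering of the typed Thm. 5.1
(`perm_d ∉ Δ[det_d] = \overline{GL_{d²}·det_d}`): by the tree's multiplicity form of Thm. 5.1 over
`ℂ` (`MS2001_thm_5_1_complex`) applied to the obstruction `W = Sym^{2d}(X)`
(`MS2001_example_5_2_1_obstruction`), `perm_d` being stable (Thm. 4.7, `MS2001_thm_4_7_complex`).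
(`d ≥ 3`: for `d = 2`, `perm₂ ∈ GL₄ · det₂`.)
[cite: MulmuleySohoniSIAM2001, §5.2.1 Example 1 (AV pp.21–22, all.txt L1491–1517); Thm. 5.1 (AV p.20, L1365); Thm. 4.7 (AV p.15, L952)] -/
theorem MS2001_example_5_2_1 {d : ℕ} (hd : 3 ≤ d) :
    perPoly (Fin d) ℂ ∉ orbitClosure (detPoly (Fin d) ℂ) := by
  have hper : (perPoly (Fin d) ℂ).IsHomogeneous d := by
    simpa using perPoly_isHomogeneous (n := Fin d) (k := ℂ)
  have hdet : (detPoly (Fin d) ℂ).IsHomogeneous d := by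
    simpa using detPoly_isHomogeneous (n := Fin d) (k := ℂ)
  exact MS2001_thm_5_1_complex (Fin d × Fin d) (perPoly (Fin d) ℂ) (detPoly (Fin d) ℂ) d hper hdet
    (MS2001_thm_4_7_complex d) ⟨d * 2, MS2001_example_5_2_1_obstruction hd le_rfl⟩

/-! ## §4 The case `a = 1` (ours): `Sym^d(X)` itself is an obstruction iff `d ≡ 1 (mod 4)`

MS take `r = ad` "for some integer `a > 1`" (AV p.22, all.txt L1505–1506). At `a = 1` the two
`H`-fixed forms `perm(X)^a` and `perm(X^{∘a})` coincide, and whether `W = Sym^d(X)` is still an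
obstruction is decided by the tree's analysis of the literal `SL(X)`-reading of "perm is
characterized by its stabilizer" (GCT II Thm. 2.3; `CharacterizedByStabilizerSL.lean`):
`(Sym^d)^{SL ∩ Stab(perm_d)} = ℂ·perm_d` for `d ≢ 1 (mod 4)` (`fixedForms_slSubgroup_perPoly_eq`) but
`⊇ ⟨perm_d, det_d⟩` for `d ≡ 1 (mod 4)`, `d ≥ 5` (`span_pair_le_fixedForms_slSubgroup_perPoly`), while
`(Sym^d)^{SL ∩ Stab(det_d)} = ℂ·det_d` always. Appendix of seat `val-lit-t01` g7 (2026-08-27). -/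

namespace MS2001Example521

/-- `perm_d` and `det_d` are linearly independent for `d ≥ 2` (evaluate at the identity and at the
all-ones matrix: `per(J) = d! ≠ 0 = det(J)`). [folklore] -/
private theorem linearIndependent_perPoly_detPoly {d : ℕ} (hd : 2 ≤ d) :
    LinearIndependent ℂ ![perPoly (Fin d) ℂ, detPoly (Fin d) ℂ] := by
  rw [LinearIndependent.pair_iff]
  intro s t hst
  have h1 := congrArg (eval fun q : Fin d × Fin d => (1 : Matrix (Fin d) (Fin d) ℂ) q.1 q.2) hst
  rw [map_add, smul_eval, smul_eval, eval_perPoly, eval_detPoly, of_point, map_zero,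
    Matrix.permanent_one, Matrix.det_one, mul_one, mul_one] at h1
  have h2 := congrArg (eval fun _ : Fin d × Fin d => (1 : ℂ)) hst
  rw [map_add, smul_eval, smul_eval, eval_perPoly, eval_detPoly, map_zero, permanent_of_one] at h2
  have hdetJ : (Matrix.of fun i j : Fin d => (fun _ : Fin d × Fin d => (1 : ℂ)) (i, j)).det = 0 := by
    refine Matrix.det_zero_of_row_eq (i := ⟨0, by omega⟩) (j := ⟨1, by omega⟩) ?_ (funext fun _ => rfl)
    simp [Fin.ext_iff]
  rw [hdetJ, mul_zero, add_zero] at h2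
  have hs : s = 0 := by
    rcases mul_eq_zero.mp h2 with h | h
    · exact h
    · exact absurd h (by exact_mod_cast (Nat.factorial_pos d).ne')
  refine ⟨hs, ?_⟩
  rw [hs, zero_add] at h1
  exact h1

end MS2001Example521

/-- **`dim (Sym^d)^{SL ∩ Stab(det_d)} = 1` at `a = 1`** (the degree-`d` instance of (Q); also the
tree's `fixedForms_slSubgroup_detPoly_eq`, GCT II Thm. 2.3's "`det(Y)` is characterized by its
stabilizer" in the `SL(Y)`-reading). [cite: MulmuleySohoniSIAM2001, §5.2.1 Example 1 (AV p.22, all.txt L1513–1516)]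
[cite: MulmuleySohoniGCT2SIAM2008, §1 (definition) and Thm. 2.3] -/
theorem finrank_fixedForms_slSubgroup_detPoly_self (d : ℕ) :
    Module.finrank ℂ (fixedForms (slSubgroup (Fin d × Fin d) ℂ) (detPoly (Fin d) ℂ) d) = 1 := by
  have h := finrank_fixedForms_slSubgroup_detPoly_mul ℂ d 1
  rwa [mul_one] at h

/-- **`dim (Sym^d)^{SL ∩ Stab(perm_d)} = 1` for `d ≢ 1 (mod 4)`** (from the tree's
`fixedForms_slSubgroup_perPoly_eq`: the `SL(X)`-reading of GCT II Thm. 2.3 "perm(X) is characterized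
by its stabilizer" holds in these residues). [cite: MulmuleySohoniGCT2SIAM2008, §1 (definition) and Thm. 2.3] -/
theorem finrank_fixedForms_slSubgroup_perPoly_self_of_mod_four_ne_one {d : ℕ} (hd : d % 4 ≠ 1) :
    Module.finrank ℂ (fixedForms (slSubgroup (Fin d × Fin d) ℂ) (perPoly (Fin d) ℂ) d) = 1 := by
  rw [fixedForms_slSubgroup_perPoly_eq hd]
  exact finrank_span_singleton (perPoly_ne_zero (Fin d) ℂ)

/-- **`2 ≤ dim (Sym^d)^{SL ∩ Stab(perm_d)}` for `d ≡ 1 (mod 4)`, `d ≥ 5`** (`⟨perm_d, det_d⟩ ⊆ W^H`,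
the tree's `span_pair_le_fixedForms_slSubgroup_perPoly`: in this residue `det_d` is fixed by every
determinant-one substitution fixing `perm_d`). Own computation from the cited stabilizer theorem.
[cite: MarcusMay1962, §2 Theorem, p. 179] [cite: MulmuleySohoniGCT2SIAM2008, §1 (definition) and Thm. 2.3] -/
theorem two_le_finrank_fixedForms_slSubgroup_perPoly_self_of_mod_four_eq_one {d : ℕ} (h5 : 5 ≤ d)
    (h1 : d % 4 = 1) :
    2 ≤ Module.finrank ℂ (fixedForms (slSubgroup (Fin d × Fin d) ℂ) (perPoly (Fin d) ℂ) d) := by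
  have hli := MS2001Example521.linearIndependent_perPoly_detPoly (d := d) (by omega)
  haveI : Module.Finite ℂ ↥(homogeneousSubmodule (Fin d × Fin d) ℂ d) :=
    finite_homogeneousSubmodule _ ℂ _
  haveI : Module.Finite ℂ ↥(fixedForms (slSubgroup (Fin d × Fin d) ℂ) (perPoly (Fin d) ℂ) d) :=
    Submodule.finiteDimensional_of_le (fun p hp => hp.1)
  have hle := span_pair_le_fixedForms_slSubgroup_perPoly (by omega) h1
  have hrange : Set.range ![perPoly (Fin d) ℂ, detPoly (Fin d) ℂ] = {perPoly (Fin d) ℂ, detPoly (Fin d) ℂ} := by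
    ext p
    simp only [Set.mem_range, Set.mem_insert_iff, Set.mem_singleton_iff]
    constructor
    · rintro ⟨i, rfl⟩
      fin_cases i <;> simp
    · rintro (rfl | rfl)
      · exact ⟨0, by simp⟩
      · exact ⟨1, by simp⟩
  calc 2 = Module.finrank ℂ (Submodule.span ℂ (Set.range ![perPoly (Fin d) ℂ, detPoly (Fin d) ℂ])) := by
        rw [finrank_span_eq_card hli]; simp
    _ ≤ _ := by
        rw [hrange]
        exact Submodule.finrank_mono hle

/-- **At `a = 1`, `W = Sym^d(X)` is an obstruction for `(perm_d, det_d)` in the sense of Thm. 5.1 iff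
`d ≡ 1 (mod 4)`** (`d ≥ 2`; ours): the printed restriction "`r = ad` … for some integer `a > 1`"
(AV p.22, all.txt L1505–1506) is necessary exactly in the residues `d ≢ 1 (mod 4)`, where
`dim W^H = dim W^Q = 1`; for `d ≡ 1 (mod 4)` (hence `d ≥ 5`) `dim W^Q = 1 < 2 ≤ dim W^H` because `det_d`
itself is `SL_{d²} ∩ Stab(perm_d)`-invariant (the failure of the literal `SL(X)`-reading of GCT II
Thm. 2.3 for the permanent, `CharacterizedByStabilizerSL.lean`).
[cite: MulmuleySohoniSIAM2001, §5.2.1 Example 1 (AV p.22, all.txt L1505–1506, L1516–1517)]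
[cite: MulmuleySohoniGCT2SIAM2008, §1 (definition) and Thm. 2.3] -/
theorem MS2001_example_5_2_1_degree_self_iff {d : ℕ} (h2 : 2 ≤ d) :
    Module.finrank ℂ (fixedForms (slSubgroup (Fin d × Fin d) ℂ) (detPoly (Fin d) ℂ) d) <
      Module.finrank ℂ (fixedForms (slSubgroup (Fin d × Fin d) ℂ) (perPoly (Fin d) ℂ) d) ↔
      d % 4 = 1 := by
  rw [finrank_fixedForms_slSubgroup_detPoly_self]
  constructor
  · intro h
    by_contra h1
    rw [finrank_fixedForms_slSubgroup_perPoly_self_of_mod_four_ne_one h1] at h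
    exact lt_irrefl 1 h
  · intro h1
    have h5 : 5 ≤ d := by omega
    exact lt_of_lt_of_le one_lt_two
      (two_le_finrank_fixedForms_slSubgroup_perPoly_self_of_mod_four_eq_one h5 h1)

/-- **GCT I (Mulmuley–Sohoni 2001), §5.2.1 Example 1 over EVERY field of characteristic `0`**
(print: `ℂ`; the setting of Thm. 5.1 is an algebraically closed field of characteristic `0`): for
`d ≥ 3`, `perm_d ∉ Δ[det_d] = \overline{GL_{d²} · det_d}` over any field `F` with `CharZero F`.
By base change from the `ℂ` theorem `MS2001_example_5_2_1`, with no invariant theory over `F`: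
`perm_d` and `det_d` are defined over `ℚ` (`map_perPoly`, `map_detPoly`), orbit-closure membership
DESCENDS along `ℚ ⊆ F` (`mem_orbitClosure_of_map_mem`, `ℚ` infinite: a polynomial identity in the
matrix entries that holds on `GL(ℚ)` holds on `GL(F)`) and ASCENDS along `ℚ ⊆ ℂ`
(`map_mem_orbitClosure_map`) — both from val-lit-x3 g5's `ZariskiClosureBaseChange.lean`
(programme #10). Appended by val-lit-t02 g9 (closer-review seat of programme #10), 2026-08-27; a
consequence of base change, no printed locator claimed for the generalisation. Honest framing: the
same-size toy separation of GCT I, known since 2001; nothing here bears on the padded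
permanent-versus-determinant problem or on VP versus VNP.
[cite: MulmuleySohoniSIAM2001, §5.2.1 Example 1 (AV pp.21–22, all.txt L1491–1517); Thm. 5.1 (AV p.20, L1365)] -/
theorem MS2001_example_5_2_1_charZero (F : Type*) [Field F] [CharZero F] {d : ℕ} (hd : 3 ≤ d) :
    perPoly (Fin d) F ∉ orbitClosure (detPoly (Fin d) F) := by
  intro h
  -- descend to `ℚ`: `perm_d`, `det_d` are the base changes of their `ℚ`-versions
  have hQ : perPoly (Fin d) ℚ ∈ orbitClosure (detPoly (Fin d) ℚ) := by
    refine mem_orbitClosure_of_map_mem (K := F) ?_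
    rwa [map_perPoly, map_detPoly]
  -- ascend to `ℂ` and contradict the `ℂ` theorem
  have hC : perPoly (Fin d) ℂ ∈ orbitClosure (detPoly (Fin d) ℂ) := by
    have h' := map_mem_orbitClosure_map (K := ℂ) hQ
    rwa [map_perPoly, map_detPoly] at h'
  exact MS2001_example_5_2_1 hd hC

end Literature.Computability.AlgebraicComplexity

end
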